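import Mathlib.LinearAlgebra.Matrix.Kronecker
import Mathlib.Logic.Equiv.Fin.Basic
import Literature.InformationTheory.QuantumCodes.AbelianTwoBlockCodes
import Literature.InformationTheory.QuantumCodes.CSS
import HarnessLib

/-!
# Bivariate-bicycle (BB) codes `QC(A, B)`: the printed definition over `𝔽₂[x,y]/(xˡ − 1, yᵐ − 1)`,
# Lemma 1 of Bravyi et al. (proved), the index convention, and the five published instances

Source: S. Bravyi, A. W. Cross, J. M. Gambetta, D. Maslov, P. Rall, T. J. Yoder, *High-threshold and
low-overhead fault-tolerant quantum memory*, Nature **627** (2024) 778–782 = arXiv:2308.07915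
[BravyiEtAl2024]: §4 "Bivariate Bicycle quantum LDPC codes" (held text `paper:arxiv-2308.07915`,
chunk p0009) = Nature Methods "Code construction" (`paper:url-cd30d32baa9f` p0006); Lemma 1
(p0009 L66–77, proof p0009 L79 – p0010 L40); Nature Table 1 (p0003 L78–82), Extended Data Table 1
caption (p0011 L2–10), Supplementary Information Table 6 (`paper:url-bcdd6c4b24ed` p0018 L1–7).
The general two-block form `H_X = [A|B]`, `H_Z = [Bᵀ|Aᵀ]` for commuting square `A, B` is
Lin–Pryadko, PRA 109 (2024) 022407, §III eq. (10) [LinPryadko2024].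

This file is the `G = ℤ_ℓ × ℤ_m` SPECIALISATION of `AbelianTwoBlockCodes.lean` (which proves, for
every finite abelian index group, the commutation `H_X H_Zᵀ = 0`, `rank H_X = rank H_Z`,
`ker H_Zᵀ = ker A ⊓ ker B`, the dimension count and the weight-preserving `X ↔ Z` transport) glued
to the CSS vocabulary of `CSS.lean` (`CSSCode`, `dX`, `dZ`, `k`). Contents:

* `BB.Mono ℓ m = Fin ℓ × Fin m` (exponents `(a, b)` of `xᵃyᵇ`, `x^ℓ = y^m = 1`, = the row/column
  index set `ℤ_ℓ × ℤ_m`), `BB.Poly ℓ m = Mono ℓ m → 𝔽₂` (an element of `𝔽₂[x,y]/(xˡ−1, yᵐ−1)` as its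
  coefficient function), `BB.toMatrix p` (the `ℓm × ℓm` matrix of `p`, entry `(i, j) = p (j − i)`;
  it is `Matrix.circulant (coeffVec p)`), `monomial`, `xPow`, `yPow`, `x`, `y`; FAITHFULNESS to the
  printed Kronecker definition: `toMatrix x = S_ℓ ⊗ I_m`, `toMatrix y = I_ℓ ⊗ S_m` with `S_ℓ` the
  cyclic shift "row `i` has its single `1` in column `i + 1 (mod ℓ)`" (`toMatrix_x_eq_kronecker`,
  `toMatrix_y_eq_kronecker`, proved); commutation and translation invariance
  (`toMatrix_add_add`, for the orbit-reduction lemma of PARTITION row type-12).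
* `BB.IsBBPoly p` — the printed side condition "`A = A₁ + A₂ + A₃`, each `Aᵢ` a power of `x` or `y`,
  the `Aᵢ` distinct" (definition, as printed).
* `BB.Code ℓ m = (A, B)`; `Code.HX = [A|B]`, `Code.HZ = [Bᵀ|Aᵀ]` (as `AbelianTwoBlock.HX/HZ` of the
  coefficient vectors — `HX_eq`, `HZ_eq` say they are literally the printed block matrices),
  `Code.css : CSSCode` (commutation proved), `BB.numQubits ℓ m = 2ℓm`, `Code.k` (= `CSSCode.k`),
  `Code.d = min (d^X, d^Z)` (the distance formula the printed proof of Lemma 1 starts from),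
  `Code.kerInter = ker A ⊓ ker B`.
* **Lemma 1 PROVED** for every `(A, B)` (the printed weight-6 hypothesis is not needed):
  `Code.k_eq_two_mul_finrank_kerInter` (`k = 2 · dim (ker A ∩ ker B)`), `Code.dX_eq_dZ` ("the code
  offers equal distance for `X`-type and `Z`-type errors"), `Code.d_eq_dZ`
  (`d = min{|v| : v ∈ ker H^X ∖ rs H^Z}`), `Code.cssMinDist_eq_d`; bundled as
  `Code.BravyiEtAl2024_lemma1`.
* The INDEX CONVENTION every kernel / emitter / referee of the `qec` cell binds to (qec
  `plan/CERT-REQS.md` §index = the construction sentence of the paper): `Code.qubitIndex`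
  sends left-block qubit `(a, b)` to `a·m + b` and right-block qubit `(a, b)` to `ℓm + a·m + b`
  (`qubitIndex_inl_val`, `qubitIndex_inr_val`), checks `(a, b) ↦ a·m + b` (`checkIndex`);
  `Code.HXFlat`, `Code.HZFlat` are the re-indexed `Fin (ℓm) × Fin (ℓm + ℓm)` matrices.
* The five published instances `bb72`, `bb90`, `bb108`, `bb144`, `bb288` as DATA `(ℓ, m, A, B)` with
  the locators actually read (`(ℓ, m)`: SI Table 6; `A, B`: the paper's in-text statements where they
  exist, otherwise the secondary printed pages named in each docstring — Extended Data Table 1's body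
  is an image in the Nature PDF and the table is stripped from the held arXiv text), each with its
  `IsBBPoly` side condition proved. Their printed parameters `[[72,12,6]]`, …, `[[288,12,18]]`
  (distance "computed by the mixed integer programming approach", ED Table 1 caption) are CLAIMS:
  they are typed Summits-side (`Summits/Ventures/QEC/…`, qec PARTITION row type-05) as
  `def … : Prop` and are NOT asserted anywhere in this file.

## What is NOT here (deliberately)
* The Pauli-group / stabilizer semantics of `H_X`, `H_Z` (tree: `SymplecticCodes.lean`, and the
  venture's `Summits/Ventures/QEC/Basic`), decoders, thresholds, Tanner-graph thickness and the toric
  layout (Lemmas 2–4 of the paper), syndrome circuits.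
* Any distance VALUE: no `d = 6`-type statement is made here (certificates discharge those).
* The orbit-reduction ("w.l.o.g. the support meets a base qubit") lemma: PARTITION row type-12
  (`toMatrix_add_add` / `HX_translate` below are the invariance facts it consumes).

`lean search` (2026-08-26): no `bicycle|BBCode|twoBlock` declarations in Mathlib; tree reuse as
imported (`AbelianTwoBlock.*`, `CSSCode.*`, `pcCode`, `rowSpace`, `cssMinDist`, Mathlib
`Matrix.circulant`, `finProdFinEquiv`, `finSumFinEquiv`, `hammingNorm`).
-/

namespace Literature.InformationTheory.QuantumCodes

namespace BB

open Matrix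
open scoped Kronecker

/-- The exponent set `{xᵃyᵇ : a ∈ ℤ_ℓ, b ∈ ℤ_m}` of the monomials of `𝔽₂[x,y]/(xˡ − 1, yᵐ − 1)`
("`x^ℓ = y^m = I_{ℓm}`"), realised as `Fin ℓ × Fin m` with its (wrap-around) additive group structure;
it is also the row/column index set of the `ℓm × ℓm` matrices `x = S_ℓ ⊗ I_m`, `y = I_ℓ ⊗ S_m`
(row `(i₁, i₂)` = row `i₁ m + i₂` of the Kronecker product, see `checkIndex`) — "the code can be
viewed as a special case of the Lifted Product construction based on the abelian group `ℤ_ℓ × ℤ_m`".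
[cite: BravyiEtAl2024, §4 (arXiv:2308.07915 chunk p0009 L13–19 and L42–44)] -/
abbrev Mono (ℓ m : ℕ) : Type := Fin ℓ × Fin m

/-- An element of `𝔽₂[x,y]/(xˡ − 1, yᵐ − 1) ≅ 𝔽₂[ℤ_ℓ × ℤ_m]`, represented computably by its
coefficient function `(a, b) ↦` coefficient of `xᵃyᵇ` ("the addition and multiplication of binary
matrices is performed modulo two"). [cite: BravyiEtAl2024, §4 (arXiv:2308.07915 chunk p0009 L20–22)] -/
abbrev Poly (ℓ m : ℕ) : Type := Mono ℓ m → ZMod 2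

variable {ℓ m : ℕ}

section GroupAlgebra

/-- The circulant (coefficient) vector of the matrix of `p`: `coeffVec p g = p (−g)`, so that
`Matrix.circulant (coeffVec p)` (entry `(i, j) ↦ coeffVec p (i − j) = p (j − i)`) is the matrix of
`p(x, y)` — see `toMatrix_apply`. [cite: BravyiEtAl2024, §4 (arXiv:2308.07915 chunk p0009 L3–16)] -/
def coeffVec (p : Poly ℓ m) : Mono ℓ m → ZMod 2 := fun g => p (-g)

/-- `coeffVec p g = p (−g)`. [cite: BravyiEtAl2024, §4 (arXiv:2308.07915 chunk p0009 L3–16)] -/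
@[simp] theorem coeffVec_apply (p : Poly ℓ m) (g : Mono ℓ m) : coeffVec p g = p (-g) := rfl

/-- The `ℓm × ℓm` binary matrix of a polynomial `p(x, y)`: entry `(i, j)` is the coefficient of
`x^{j₁−i₁} y^{j₂−i₂}`; for `p = x` this says "the `i`-th row of `S_ℓ` has a single nonzero entry
equal to one at the column `i + 1 (mod ℓ)`", `x = S_ℓ ⊗ I_m`, `y = I_ℓ ⊗ S_m` (faithfulness:
`toMatrix_x_eq_kronecker`, `toMatrix_y_eq_kronecker`). Computable.
[cite: BravyiEtAl2024, §4 (arXiv:2308.07915 chunk p0009 L3–16)] -/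
def toMatrix (p : Poly ℓ m) : Matrix (Mono ℓ m) (Mono ℓ m) (ZMod 2) := circulant (coeffVec p)

/-- `toMatrix p` is Mathlib's `circulant` of its coefficient vector (definitional).
[cite: BravyiEtAl2024, §4 (arXiv:2308.07915 chunk p0009 L3–16)] -/
theorem toMatrix_eq_circulant (p : Poly ℓ m) : toMatrix p = circulant (coeffVec p) := rfl

variable [NeZero ℓ] [NeZero m]

/-- Entry formula: `toMatrix p i j = p (j − i)`. [cite: BravyiEtAl2024, §4 (arXiv:2308.07915 chunk p0009 L3–16)] -/
@[simp] theorem toMatrix_apply (p : Poly ℓ m) (i j : Mono ℓ m) : toMatrix p i j = p (j - i) := by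
  simp [toMatrix, circulant_apply, neg_sub]

/-- The monomial `xᵃyᵇ` (coefficient function `Pi.single (a, b) 1`).
[cite: BravyiEtAl2024, §4 (arXiv:2308.07915 chunk p0009 L19–22)] -/
def monomial (a : Fin ℓ) (b : Fin m) : Poly ℓ m := Pi.single (a, b) 1

/-- `xᵃ` for a natural exponent `a` (reduced `mod ℓ`: "`x^ℓ = I`"); `xPow 0 = 1`.
[cite: BravyiEtAl2024, §4 (arXiv:2308.07915 chunk p0009 L19–22)] -/
def xPow (a : ℕ) : Poly ℓ m := monomial (Fin.ofNat ℓ a) 0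

/-- `yᵇ` for a natural exponent `b` (reduced `mod m`: "`y^m = I`").
[cite: BravyiEtAl2024, §4 (arXiv:2308.07915 chunk p0009 L19–22)] -/
def yPow (b : ℕ) : Poly ℓ m := monomial 0 (Fin.ofNat m b)

/-- `x` (as a polynomial: the monomial `x¹y⁰ = monomial 1 0`; as a matrix `S_ℓ ⊗ I_m`,
`toMatrix_x_eq_kronecker`).
[cite: BravyiEtAl2024, §4 (arXiv:2308.07915 chunk p0009 L16)] -/
def x : Poly ℓ m := monomial 1 0

/-- `y` (the monomial `x⁰y¹ = monomial 0 1`; as a matrix `I_ℓ ⊗ S_m`, `toMatrix_y_eq_kronecker`).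
[cite: BravyiEtAl2024, §4 (arXiv:2308.07915 chunk p0009 L16)] -/
def y : Poly ℓ m := monomial 0 1

/-- Entries of the matrix of a monomial: `toMatrix (xᵃyᵇ) i j = 1` iff `j = i + (a, b)`, else `0`.
[cite: BravyiEtAl2024, §4 (arXiv:2308.07915 chunk p0009 L3–16)] -/
theorem toMatrix_monomial_apply (a : Fin ℓ) (b : Fin m) (i j : Mono ℓ m) :
    toMatrix (monomial a b) i j = if j = i + (a, b) then 1 else 0 := by
  rw [toMatrix_apply, monomial]
  by_cases h : j = i + (a, b)
  · subst h; simp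
  · rw [if_neg h, Pi.single_eq_of_ne]
    intro h'; exact h (by rw [← h', add_sub_cancel])

/-- The cyclic shift matrix `S_ℓ`: "the `i`-th row of `S_ℓ` has a single nonzero entry equal to one
at the column `i + 1 (mod ℓ)`" (e.g. `S_2 = [[0,1],[1,0]]`), rows/columns indexed by `ℤ_ℓ = Fin ℓ`.
[cite: BravyiEtAl2024, §4 (arXiv:2308.07915 chunk p0009 L3–11)] -/
def cyclicShift (ℓ : ℕ) [NeZero ℓ] : Matrix (Fin ℓ) (Fin ℓ) (ZMod 2) :=
  of fun i j => if j = i + 1 then 1 else 0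

/-- FAITHFULNESS: the matrix of `x` is literally `S_ℓ ⊗ I_m`.
[cite: BravyiEtAl2024, §4 eq. "x = S_ℓ ⊗ I_m" (arXiv:2308.07915 chunk p0009 L16)] -/
theorem toMatrix_x_eq_kronecker :
    toMatrix (x : Poly ℓ m) = cyclicShift ℓ ⊗ₖ (1 : Matrix (Fin m) (Fin m) (ZMod 2)) := by
  ext ⟨i₁, i₂⟩ ⟨j₁, j₂⟩
  simp only [x, toMatrix_monomial_apply, Prod.mk_add_mk, add_zero, Prod.mk.injEq,
    kroneckerMap_apply, cyclicShift, of_apply, one_apply]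
  by_cases h₁ : j₁ = i₁ + 1 <;> by_cases h₂ : i₂ = j₂ <;> simp [h₁, h₂, eq_comm]

/-- FAITHFULNESS: the matrix of `y` is literally `I_ℓ ⊗ S_m`.
[cite: BravyiEtAl2024, §4 eq. "y = I_ℓ ⊗ S_m" (arXiv:2308.07915 chunk p0009 L16)] -/
theorem toMatrix_y_eq_kronecker :
    toMatrix (y : Poly ℓ m) = (1 : Matrix (Fin ℓ) (Fin ℓ) (ZMod 2)) ⊗ₖ cyclicShift m := by
  ext ⟨i₁, i₂⟩ ⟨j₁, j₂⟩
  simp only [y, toMatrix_monomial_apply, Prod.mk_add_mk, add_zero, Prod.mk.injEq,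
    kroneckerMap_apply, cyclicShift, of_apply, one_apply]
  by_cases h₁ : i₁ = j₁ <;> by_cases h₂ : j₂ = i₂ + 1 <;> simp [h₁, h₂, eq_comm]

/-- Any two polynomials in `x, y` have commuting matrices ("`AB = BA` since `xy = yx`"): the index
group `ℤ_ℓ × ℤ_m` is abelian (`Matrix.circulant_mul_comm`).
[cite: BravyiEtAl2024, §4 (arXiv:2308.07915 chunk p0009 L19 and L24)] -/
theorem toMatrix_mul_comm (p q : Poly ℓ m) : toMatrix p * toMatrix q = toMatrix q * toMatrix p :=
  circulant_mul_comm _ _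

/-- Transposition is inversion of exponents: `(toMatrix p)ᵀ = toMatrix (xᵃyᵇ ↦ p(x⁻ᵃy⁻ᵇ))` (the
identity `Aᵀ = CAC`, `C : g ↦ −g`, of the printed proof of Lemma 1).
[cite: BravyiEtAl2024, proof of Lemma 1 (arXiv:2308.07915 chunk p0009 L86–90)] -/
theorem transpose_toMatrix (p : Poly ℓ m) : (toMatrix p)ᵀ = toMatrix fun g => p (-g) := by
  ext i j; simp [neg_sub]

/-- Translation invariance: the matrix of `p` is constant along the diagonal action of `ℤ_ℓ × ℤ_m`,
`toMatrix p (i + t) (j + t) = toMatrix p i j` (the symmetry used by the qec orbit-reduction lemma).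
[cite: BravyiEtAl2024, §4 (arXiv:2308.07915 chunk p0009 L3–16 and L42–44: group-algebra structure over ℤ_ℓ × ℤ_m)] -/
theorem toMatrix_add_add (p : Poly ℓ m) (i j t : Mono ℓ m) :
    toMatrix p (i + t) (j + t) = toMatrix p i j := by
  simp [add_sub_add_right_eq_sub]

/-- The printed side condition on `A` (and on `B`): "`A = A₁ + A₂ + A₃` where each matrix `Aᵢ` is a
power of `x` or `y` … we also assume the `Aᵢ` are distinct" — `p` is a sum of three pairwise distinct
monomials `x^{a}y^{b}` each with `a = 0` or `b = 0`. (Definition, as printed; Lemma 1 below does not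
use it.) [cite: BravyiEtAl2024, §4 (arXiv:2308.07915 chunk p0009 L20–22)] -/
def IsBBPoly (p : Poly ℓ m) : Prop :=
  ∃ g₁ g₂ g₃ : Mono ℓ m, g₁ ≠ g₂ ∧ g₁ ≠ g₃ ∧ g₂ ≠ g₃ ∧
    ((g₁.1 = 0 ∨ g₁.2 = 0) ∧ (g₂.1 = 0 ∨ g₂.2 = 0) ∧ (g₃.1 = 0 ∨ g₃.2 = 0)) ∧
    p = monomial g₁.1 g₁.2 + monomial g₂.1 g₂.2 + monomial g₃.1 g₃.2

end GroupAlgebra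

/-! ### The code `QC(A, B)` -/

/-- The data of a bivariate-bicycle code `QC(A, B)`: two polynomials
`A, B ∈ 𝔽₂[x,y]/(xˡ − 1, yᵐ − 1)` ("A BB code is defined by a pair of matrices `A = A₁ + A₂ + A₃` and
`B = B₁ + B₂ + B₃`"). The weight-(3,3) side condition is the separate hypothesis `IsBBPoly`, kept out of
the structure so that the same object covers all abelian two-block codes on `ℤ_ℓ × ℤ_m`.
[cite: BravyiEtAl2024, §4 (arXiv:2308.07915 chunk p0009 L20–29)] -/
structure Code (ℓ m : ℕ) where
  /-- the polynomial `A(x, y)` -/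
  A : Poly ℓ m
  /-- the polynomial `B(x, y)` -/
  B : Poly ℓ m

/-- The number of data qubits of a code on `ℤ_ℓ × ℤ_m`: the size of the column index set
`Mono ℓ m ⊕ Mono ℓ m` (left block `L`, right block `R`); `= 2ℓm` (`numQubits_eq`).
[cite: BravyiEtAl2024, §4 and Lemma 1 "n = 2ℓm" (arXiv:2308.07915 chunk p0009 L27 and L71)] -/
def numQubits (ℓ m : ℕ) : ℕ := Fintype.card (Mono ℓ m ⊕ Mono ℓ m)

/-- "`n = 2ℓm`". [cite: BravyiEtAl2024, Lemma 1 (arXiv:2308.07915 chunk p0009 L71)] -/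
theorem numQubits_eq (ℓ m : ℕ) : numQubits ℓ m = 2 * ℓ * m := by
  simp only [numQubits, Fintype.card_sum, Fintype.card_prod, Fintype.card_fin]; ring

namespace Code

/-! #### Index convention (flattening to `0 … 2ℓm − 1`) -/

/-- Row (check) index convention: check `(a, b) ∈ ℤ_ℓ × ℤ_m ↦ a·m + b ∈ {0, …, ℓm − 1}` — the row
order of the Kronecker products `S_ℓ ⊗ I_m`, `I_ℓ ⊗ S_m` (Mathlib `finProdFinEquiv`).
[cite: BravyiEtAl2024, §4 eq. "x = S_ℓ ⊗ I_m, y = I_ℓ ⊗ S_m" (arXiv:2308.07915 chunk p0009 L16)] -/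
def checkIndex : Mono ℓ m ≃ Fin (ℓ * m) := finProdFinEquiv

/-- Qubit (column) index convention: left-block qubit `(a, b) ↦ a·m + b`, right-block qubit
`(a, b) ↦ ℓm + a·m + b` ("`H^X = [A|B]` … the vertical bar indicates stacking matrices horizontally":
block `L` = columns `0 … ℓm−1`, block `R` = columns `ℓm … 2ℓm−1`).
[cite: BravyiEtAl2024, §4 (arXiv:2308.07915 chunk p0009 L16 and L28–31)] -/
def qubitIndex : Mono ℓ m ⊕ Mono ℓ m ≃ Fin (ℓ * m + ℓ * m) :=
  (Equiv.sumCongr finProdFinEquiv finProdFinEquiv).trans finSumFinEquiv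

/-- `checkIndex (a, b) = a·m + b`. [cite: BravyiEtAl2024, §4 (arXiv:2308.07915 chunk p0009 L16)] -/
theorem checkIndex_val (a : Fin ℓ) (b : Fin m) :
    ((checkIndex (a, b) : Fin (ℓ * m)) : ℕ) = a * m + b := by
  simp [checkIndex, mul_comm, add_comm]

/-- `qubitIndex (L, (a, b)) = a·m + b`. [cite: BravyiEtAl2024, §4 (arXiv:2308.07915 chunk p0009 L16 and L28–31)] -/
theorem qubitIndex_inl_val (a : Fin ℓ) (b : Fin m) :
    ((qubitIndex (Sum.inl (a, b)) : Fin (ℓ * m + ℓ * m)) : ℕ) = a * m + b := by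
  simp [qubitIndex, mul_comm, add_comm]

/-- `qubitIndex (R, (a, b)) = ℓm + a·m + b`. [cite: BravyiEtAl2024, §4 (arXiv:2308.07915 chunk p0009 L16 and L28–31)] -/
theorem qubitIndex_inr_val (a : Fin ℓ) (b : Fin m) :
    ((qubitIndex (Sum.inr (a, b)) : Fin (ℓ * m + ℓ * m)) : ℕ) = ℓ * m + (a * m + b) := by
  simp [qubitIndex, mul_comm, add_comm]

variable (C : Code ℓ m)

/-- `H^X = [A | B]` of `QC(A, B)`, rows indexed by `ℤ_ℓ × ℤ_m`, columns by the two qubit blocks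
`(ℤ_ℓ × ℤ_m) ⊕ (ℤ_ℓ × ℤ_m)`; by definition the abelian two-block matrix `AbelianTwoBlock.HX` of the
coefficient vectors, and literally `[toMatrix A | toMatrix B]` (`HX_eq`).
[cite: BravyiEtAl2024, §4 eq. "H^X = [A|B]" (arXiv:2308.07915 chunk p0009 L28–31)] -/
def HX : Matrix (Mono ℓ m) (Mono ℓ m ⊕ Mono ℓ m) (ZMod 2) :=
  AbelianTwoBlock.HX (coeffVec C.A) (coeffVec C.B)

/-- `H^Z = [Bᵀ | Aᵀ]` of `QC(A, B)` (`HZ_eq`). [cite: BravyiEtAl2024, §4 eq. "H^Z = [B^T|A^T]" (arXiv:2308.07915 chunk p0009 L28–31)] -/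
def HZ : Matrix (Mono ℓ m) (Mono ℓ m ⊕ Mono ℓ m) (ZMod 2) :=
  AbelianTwoBlock.HZ (coeffVec C.A) (coeffVec C.B)

/-- `H^X` is literally the printed block matrix `[A | B]`.
[cite: BravyiEtAl2024, §4 eq. "H^X = [A|B]" (arXiv:2308.07915 chunk p0009 L28–31)] -/
theorem HX_eq : C.HX = fromCols (toMatrix C.A) (toMatrix C.B) := rfl

/-- `H^Z` is literally the printed block matrix `[Bᵀ | Aᵀ]`.
[cite: BravyiEtAl2024, §4 eq. "H^Z = [B^T|A^T]" (arXiv:2308.07915 chunk p0009 L28–31)] -/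
theorem HZ_eq : C.HZ = fromCols (toMatrix C.B)ᵀ (toMatrix C.A)ᵀ := rfl

variable [NeZero ℓ] [NeZero m]

/-- CSS commutation for every `QC(A, B)`: `H^X (H^Z)ᵀ = AB + BA = 0 (mod 2)`.
[cite: BravyiEtAl2024, §4 (arXiv:2308.07915 chunk p0009 L35)] -/
theorem HX_mul_HZ_transpose : C.HX * C.HZᵀ = 0 :=
  AbelianTwoBlock.HX_mul_HZ_transpose_eq_zero (by decide) _ _

/-- `QC(A, B)` as a CSS code presented by check matrices (the tree's `CSSCode`: `(H^X, H^Z)` with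
`H^X (H^Z)ᵀ = 0`). [cite: BravyiEtAl2024, §4 (arXiv:2308.07915 chunk p0009 L25–35)] -/
def css : CSSCode (Mono ℓ m) (Mono ℓ m) (Mono ℓ m ⊕ Mono ℓ m) :=
  ⟨C.HX, C.HZ, C.HX_mul_HZ_transpose⟩

/-- `C.css.HX = C.HX`. [cite: BravyiEtAl2024, §4 (arXiv:2308.07915 chunk p0009 L28–31)] -/
@[simp] theorem css_HX : C.css.HX = C.HX := rfl

/-- `C.css.HZ = C.HZ`. [cite: BravyiEtAl2024, §4 (arXiv:2308.07915 chunk p0009 L28–31)] -/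
@[simp] theorem css_HZ : C.css.HZ = C.HZ := rfl

/-- `H^X`, `H^Z` in the flat index convention: `Fin (ℓm)` rows (`checkIndex`) and `Fin (ℓm + ℓm)`
columns (`qubitIndex`). [cite: BravyiEtAl2024, §4 (arXiv:2308.07915 chunk p0009 L16 and L28–32)] -/
def HXFlat : Matrix (Fin (ℓ * m)) (Fin (ℓ * m + ℓ * m)) (ZMod 2) :=
  reindex checkIndex qubitIndex C.HX

/-- `H^Z` in the flat index convention (see `HXFlat`).
[cite: BravyiEtAl2024, §4 (arXiv:2308.07915 chunk p0009 L16 and L28–32)] -/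
def HZFlat : Matrix (Fin (ℓ * m)) (Fin (ℓ * m + ℓ * m)) (ZMod 2) :=
  reindex checkIndex qubitIndex C.HZ

/-- Diagonal translation by `t ∈ ℤ_ℓ × ℤ_m` acting on both qubit blocks.
[cite: BravyiEtAl2024, §4 (arXiv:2308.07915 chunk p0009 L42–44: the code is a lifted product over the abelian group ℤ_ℓ × ℤ_m)] -/
def translate (t : Mono ℓ m) : Mono ℓ m ⊕ Mono ℓ m ≃ Mono ℓ m ⊕ Mono ℓ m :=
  Equiv.sumCongr (Equiv.addRight t) (Equiv.addRight t)

/-- Translation invariance of `H^X`: `H^X (i + t) (q + t) = H^X i q` (both blocks shifted by `t`).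
[cite: BravyiEtAl2024, §4 (arXiv:2308.07915 chunk p0009 L42–44)] -/
theorem HX_translate (t i : Mono ℓ m) (q : Mono ℓ m ⊕ Mono ℓ m) :
    C.HX (i + t) (translate t q) = C.HX i q := by
  rcases q with q | q
  · simp [HX_eq, translate]
  · simp [HX_eq, translate]

/-- Translation invariance of `H^Z`. [cite: BravyiEtAl2024, §4 (arXiv:2308.07915 chunk p0009 L42–44)] -/
theorem HZ_translate (t i : Mono ℓ m) (q : Mono ℓ m ⊕ Mono ℓ m) :
    C.HZ (i + t) (translate t q) = C.HZ i q := by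
  rcases q with q | q
  · simp [HZ_eq, translate, transpose_apply]
  · simp [HZ_eq, translate, transpose_apply]

/-! #### Parameters and Lemma 1 -/

/-- The number of logical qubits `k` of `QC(A, B)`: the CSS dimension (`CSSCode.k`, with
`k = n − rk H^X − rk H^Z` = `CSSCode.k_eq`, the formula the printed proof of Lemma 1 starts from).
[cite: BravyiEtAl2024, proof of Lemma 1 "k = n − rk H^X − rk H^Z" (arXiv:2308.07915 chunk p0009 L80–83)] -/
noncomputable def k : ℕ := C.css.k

/-- The distance `d = min (d^X, d^Z)` of `QC(A, B)` ("a CSS code with check matrices `H^X` and `H^Z`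
has distance `d = min(d^X, d^Z)`", the folklore the printed proof invokes), with `d^X`, `d^Z` the
tree's `CSSCode.dX/dZ` (`ℕ`-valued, junk value `0` iff `k = 0`). By Lemma 1, `d = d^Z = d^X`
(`d_eq_dZ`, `d_eq_dX`). [cite: BravyiEtAl2024, proof of Lemma 1 (arXiv:2308.07915 chunk p0009 L108–118)] -/
noncomputable def d : ℕ := min C.css.dX C.css.dZ

/-- `ker A ∩ ker B ≤ 𝔽₂^{ℓm}`. [cite: BravyiEtAl2024, Lemma 1 (arXiv:2308.07915 chunk p0009 L72)] -/
def kerInter : Submodule (ZMod 2) (Mono ℓ m → ZMod 2) :=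
  LinearMap.ker (toMatrix C.A).mulVecLin ⊓ LinearMap.ker (toMatrix C.B).mulVecLin

/-- **Lemma 1, dimension** — `k = 2 · dim (ker A ∩ ker B)`, for every `QC(A, B)` on `ℤ_ℓ × ℤ_m`
(from `AbelianTwoBlock.two_mul_card_eq_rank_add` and `CSSCode.k_eq`). Proved.
[cite: BravyiEtAl2024, Lemma 1 "k = 2 · dim(ker A ∩ ker B)" (arXiv:2308.07915 chunk p0009 L66–75; proof L79–106)] -/
theorem k_eq_two_mul_finrank_kerInter : C.k = 2 * Module.finrank (ZMod 2) C.kerInter := by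
  have h := AbelianTwoBlock.two_mul_card_eq_rank_add (F := ZMod 2) (coeffVec C.A) (coeffVec C.B)
  have hk := C.css.k_eq
  rw [Fintype.card_sum] at hk
  change C.css.k = Fintype.card (Mono ℓ m) + Fintype.card (Mono ℓ m)
      - (AbelianTwoBlock.HX (coeffVec C.A) (coeffVec C.B)).rank
      - (AbelianTwoBlock.HZ (coeffVec C.A) (coeffVec C.B)).rank at hk
  change C.css.k = 2 * Module.finrank (ZMod 2)
      ↥(LinearMap.ker (circulant (coeffVec C.A)).mulVecLin ⊓
        LinearMap.ker (circulant (coeffVec C.B)).mulVecLin)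
  omega

/-- **Lemma 1, `X ↔ Z` symmetry** — "The code offers equal distance for `X`-type and `Z`-type errors":
`d^X = d^Z` for every `QC(A, B)` on `ℤ_ℓ × ℤ_m`, by the weight-preserving coordinate permutation
`(α, β) ↦ (Cβ, Cα)` (`AbelianTwoBlock.colSwap`) exchanging `ker H^Z ∖ rs H^X` and
`ker H^X ∖ rs H^Z`. Proved. [cite: BravyiEtAl2024, Lemma 1 and proof "d^X = d^Z" (arXiv:2308.07915 chunk p0009 L77; chunk p0010 L1–39)] -/
theorem dX_eq_dZ : C.css.dX = C.css.dZ := by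
  rw [CSSCode.dZ_eq]
  unfold CSSCode.dX
  congr 1
  refine Set.ext fun w => ⟨?_, ?_⟩
  · rintro ⟨v, ⟨hv, hv'⟩, rfl⟩
    have hv₁ : C.HZ *ᵥ v = 0 := hv
    refine ⟨v ∘ AbelianTwoBlock.colSwap (Mono ℓ m), ⟨?_, fun h => hv' ?_⟩,
      AbelianTwoBlock.hammingNorm_comp_colSwap v⟩
    · exact (AbelianTwoBlock.HZ_mulVec_eq_zero_iff (coeffVec C.A) (coeffVec C.B) v).1 hv₁
    · exact (AbelianTwoBlock.mem_range_vecMulLinear_HX_iff (coeffVec C.A) (coeffVec C.B) v).2 h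
  · rintro ⟨v, ⟨hv, hv'⟩, rfl⟩
    have hv₁ : C.HX *ᵥ v = 0 := hv
    refine ⟨v ∘ AbelianTwoBlock.colSwap (Mono ℓ m), ⟨?_, fun h => hv' ?_⟩,
      AbelianTwoBlock.hammingNorm_comp_colSwap v⟩
    · exact (AbelianTwoBlock.HX_mulVec_eq_zero_iff (coeffVec C.A) (coeffVec C.B) v).1 hv₁
    · exact (AbelianTwoBlock.mem_range_vecMulLinear_HZ_iff (coeffVec C.A) (coeffVec C.B) v).2 h

/-- **Lemma 1, distance** — `d = min{|v| : v ∈ ker H^X ∖ rs H^Z}` (`= d^Z`). Proved.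
[cite: BravyiEtAl2024, Lemma 1 (arXiv:2308.07915 chunk p0009 L74)] -/
theorem d_eq_dZ : C.d = C.css.dZ := by
  rw [d, dX_eq_dZ, min_self]

/-- Equivalently `d = d^X`. [cite: BravyiEtAl2024, Lemma 1 and proof (arXiv:2308.07915 chunk p0009 L74–77)] -/
theorem d_eq_dX : C.d = C.css.dX := by
  rw [d, ← dX_eq_dZ, min_self]

/-- Link with the Tillich–Zémor `ℕ∞`-valued minimum distance of the pair `(H^X, H^Z)`: for `k > 0`,
`cssMinDist H^X H^Z = d`. [cite: BravyiEtAl2024, proof of Lemma 1 "d = min(d^X, d^Z)" (arXiv:2308.07915 chunk p0009 L108–110)] -/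
theorem cssMinDist_eq_d (hk : 0 < C.k) : cssMinDist C.HX C.HZ = (C.d : ℕ∞) :=
  C.css.cssMinDist_eq_min_dX_dZ hk

/-- **[BravyiEtAl2024] Lemma 1** as printed, assembled: "The code `QC(A, B)` has parameters
`[[n, k, d]]`, where `n = 2ℓm`, `k = 2 · dim (ker A ∩ ker B)`, and `d = min{|v| : v ∈ ker H^X ∖ rs H^Z}`.
The code offers equal distance for `X`-type and `Z`-type errors." Proved (for every `(A, B)`; the
printed weight-6 hypothesis `IsBBPoly` is not needed).
[cite: BravyiEtAl2024, Lemma 1 (arXiv:2308.07915 chunk p0009 L66–77; Nature 627 Methods Lemma 1)] -/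
theorem BravyiEtAl2024_lemma1 :
    numQubits ℓ m = 2 * ℓ * m ∧ C.k = 2 * Module.finrank (ZMod 2) C.kerInter ∧
      C.d = C.css.dZ ∧ C.css.dX = C.css.dZ :=
  ⟨numQubits_eq ℓ m, C.k_eq_two_mul_finrank_kerInter, C.d_eq_dZ, C.dX_eq_dZ⟩

end Code

/-! ### The five published instances (DATA; their `[[n, k, d]]` are CLAIMS typed Summits-side)

`(ℓ, m)` of each code is printed in Supplementary Information Table 6, column "Base Order"
(`paper:url-bcdd6c4b24ed` p0018 L1–7: `x6,y6 / x15,y3 / x9,y6 / x12,y6 / x12,y12` for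
`[[72,12,6]] / [[90,8,10]] / [[108,8,10]] / [[144,12,12]] / [[288,12,18]]`). The polynomials `A, B`
are the last two columns of Extended Data Table 1 (= arXiv Table 3), whose body is an image in the
Nature PDF and is stripped from the held arXiv text (qec `WANTED` W1, acq-11573); each docstring names
the printed page the pair was read on (the paper's own text where it exists, otherwise a secondary
printed source restating the row), all mutually consistent.
-/

section Instances

/-- The `[[72,12,6]]` code: `ℓ = 6, m = 6`, `A = x³ + y + y²`, `B = y³ + x + x²`. `(ℓ, m)`: SI Table 6
(`paper:url-bcdd6c4b24ed` p0018 L2 "x6,y 6"); `A, B`: the paper's running example "one could choose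
`A = x³+y+y²` and `B = y³+x+x²`" (arXiv chunk p0009 L23; Nature Methods p0006 L34) is not tied to
`(6,6)` in the held text — the pairing is read on the secondary page arXiv:2502.20189 chunk p0007 L3:
"`[[72,12,6]]` with `(ℓ,m)=(6,6)` … `[[108,8,10]]` with `(ℓ,m)=(9,6)` and `[[144,12,12]]` (Gross code)
with `(ℓ,m)=(12,6)`, all three codes having `A=x³+y+y²` and `B=y³+x+x²`". DATA; its printed
parameters are a CLAIM (Nature Table 1, `paper:url-cd30d32baa9f` p0003 L78), not asserted here.
[cite: BravyiEtAl2024, Extended Data Table 1 / arXiv Table 3 row [[72,12,6]]; SI Table 6 (p. 18); §4 (arXiv chunk p0009 L23)] -/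
def bb72 : Code 6 6 := ⟨xPow 3 + yPow 1 + yPow 2, yPow 3 + xPow 1 + xPow 2⟩

/-- The `[[90,8,10]]` code: `ℓ = 15, m = 3`, `A = x⁹ + y + y²`, `B = 1 + x² + x⁷`. Primary text: "the
`[[90,8,10]]` code with `x¹⁵ = y³ = 1`" (arXiv chunk p0023 L8; SI p0016 L45) and "`B = 1 + x² + x⁷`"
(arXiv chunk p0023 L14; SI p0017 L15); SI Table 6 p0018 L3 "x15,y 3". `A` read on the secondary
page arXiv:2411.03302 chunk p0017 L59–65: "For the bivariate bicycle `[[90,8,10]]` code, let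
`j = 15, k = 3` … `A = α⁹ + β + β²`, `B = 1 + α² + α⁷`". DATA; parameters = CLAIM (Nature Table 1 p0003 L79).
[cite: BravyiEtAl2024, Extended Data Table 1 / arXiv Table 3 row [[90,8,10]]; SI §5 and Table 6 (pp. 17–18); arXiv chunk p0023 L8–14] -/
def bb90 : Code 15 3 := ⟨xPow 9 + yPow 1 + yPow 2, xPow 0 + xPow 2 + xPow 7⟩

/-- The `[[108,8,10]]` code: `ℓ = 9, m = 6`, `A = x³ + y + y²`, `B = y³ + x + x²`. `(ℓ, m)`: SI Table 6
p0018 L4 "x9,y 6"; `A, B`: secondary page arXiv:2502.20189 chunk p0007 L3 (quoted under `bb72`).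
DATA; parameters = CLAIM (Nature Table 1 p0003 L80).
[cite: BravyiEtAl2024, Extended Data Table 1 / arXiv Table 3 row [[108,8,10]]; SI Table 6 (p. 18)] -/
def bb108 : Code 9 6 := ⟨xPow 3 + yPow 1 + yPow 2, yPow 3 + xPow 1 + xPow 2⟩

/-- The `[[144,12,12]]` ("gross") code: `ℓ = 12, m = 6`, `A = x³ + y + y²`, `B = y³ + x + x²`. Primary
text: "consider the code `[[144,12,12]]` … Then `A = x³+y+y²`, `A₂ = y`, and `A₃ = y²` … which has
order `m = 6`" (arXiv chunk p0010 L82–84; Nature Methods p0007 L10–11); SI Table 6 p0018 L5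
"x12,y 6"; `B`: secondary page arXiv:2502.20189 chunk p0007 L3 (quoted under `bb72`). DATA;
parameters = CLAIM (Nature Table 1 p0003 L81).
[cite: BravyiEtAl2024, Extended Data Table 1 / arXiv Table 3 row [[144,12,12]]; arXiv chunk p0010 L82–84; SI Table 6 (p. 18)] -/
def bb144 : Code 12 6 := ⟨xPow 3 + yPow 1 + yPow 2, yPow 3 + xPow 1 + xPow 2⟩

/-- The `[[288,12,18]]` code: `ℓ = 12, m = 12`, `A = x³ + y² + y⁷`, `B = y³ + x + x²`. `(ℓ, m)`: SI
Table 6 p0018 L6 "x12,y 12"; `A, B`: secondary page arXiv:2503.03827 chunk p0007 L135: "the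
`[[288,12,18]]` code in Ref. [Bravyi2024HighThreshold], which uses `f(x,y) = x³ + y² + y⁷` and
`g(x,y) = x + x² + y³`". DATA; parameters = CLAIM (Nature Table 1 p0003 L82).
[cite: BravyiEtAl2024, Extended Data Table 1 / arXiv Table 3 row [[288,12,18]]; SI Table 6 (p. 18)] -/
def bb288 : Code 12 12 := ⟨xPow 3 + yPow 2 + yPow 7, yPow 3 + xPow 1 + xPow 2⟩

/-- The qubit counts `n = 2ℓm` of the five instances: `72, 90, 108, 144, 288`. Proved (counting).
[cite: BravyiEtAl2024, Table 1 (Nature 627 p. 780; paper:url-cd30d32baa9f p0003 L78–82)] -/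
theorem numQubits_instances : numQubits 6 6 = 72 ∧ numQubits 15 3 = 90 ∧ numQubits 9 6 = 108 ∧
    numQubits 12 6 = 144 ∧ numQubits 12 12 = 288 := by
  simp only [numQubits_eq]; decide

/-- `bb72` satisfies the printed side condition (three distinct powers of `x` or `y` in `A` and in `B`).
[cite: BravyiEtAl2024, §4 (arXiv:2308.07915 chunk p0009 L20–24)] -/
theorem isBBPoly_bb72 : IsBBPoly bb72.A ∧ IsBBPoly bb72.B :=
  ⟨⟨(Fin.ofNat 6 3, 0), (0, Fin.ofNat 6 1), (0, Fin.ofNat 6 2), by decide, by decide, by decide,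
      ⟨Or.inr rfl, Or.inl rfl, Or.inl rfl⟩, rfl⟩,
    ⟨(0, Fin.ofNat 6 3), (Fin.ofNat 6 1, 0), (Fin.ofNat 6 2, 0), by decide, by decide, by decide,
      ⟨Or.inl rfl, Or.inr rfl, Or.inr rfl⟩, rfl⟩⟩

/-- `bb90` satisfies the printed side condition. [cite: BravyiEtAl2024, §4 (arXiv:2308.07915 chunk p0009 L20–24)] -/
theorem isBBPoly_bb90 : IsBBPoly bb90.A ∧ IsBBPoly bb90.B :=
  ⟨⟨(Fin.ofNat 15 9, 0), (0, Fin.ofNat 3 1), (0, Fin.ofNat 3 2), by decide, by decide, by decide,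
      ⟨Or.inr rfl, Or.inl rfl, Or.inl rfl⟩, rfl⟩,
    ⟨(Fin.ofNat 15 0, 0), (Fin.ofNat 15 2, 0), (Fin.ofNat 15 7, 0), by decide, by decide, by decide,
      ⟨Or.inr rfl, Or.inr rfl, Or.inr rfl⟩, rfl⟩⟩

/-- `bb108` satisfies the printed side condition. [cite: BravyiEtAl2024, §4 (arXiv:2308.07915 chunk p0009 L20–24)] -/
theorem isBBPoly_bb108 : IsBBPoly bb108.A ∧ IsBBPoly bb108.B :=
  ⟨⟨(Fin.ofNat 9 3, 0), (0, Fin.ofNat 6 1), (0, Fin.ofNat 6 2), by decide, by decide, by decide,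
      ⟨Or.inr rfl, Or.inl rfl, Or.inl rfl⟩, rfl⟩,
    ⟨(0, Fin.ofNat 6 3), (Fin.ofNat 9 1, 0), (Fin.ofNat 9 2, 0), by decide, by decide, by decide,
      ⟨Or.inl rfl, Or.inr rfl, Or.inr rfl⟩, rfl⟩⟩

/-- `bb144` satisfies the printed side condition. [cite: BravyiEtAl2024, §4 (arXiv:2308.07915 chunk p0009 L20–24)] -/
theorem isBBPoly_bb144 : IsBBPoly bb144.A ∧ IsBBPoly bb144.B :=
  ⟨⟨(Fin.ofNat 12 3, 0), (0, Fin.ofNat 6 1), (0, Fin.ofNat 6 2), by decide, by decide, by decide,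
      ⟨Or.inr rfl, Or.inl rfl, Or.inl rfl⟩, rfl⟩,
    ⟨(0, Fin.ofNat 6 3), (Fin.ofNat 12 1, 0), (Fin.ofNat 12 2, 0), by decide, by decide, by decide,
      ⟨Or.inl rfl, Or.inr rfl, Or.inr rfl⟩, rfl⟩⟩

/-- `bb288` satisfies the printed side condition. [cite: BravyiEtAl2024, §4 (arXiv:2308.07915 chunk p0009 L20–24)] -/
theorem isBBPoly_bb288 : IsBBPoly bb288.A ∧ IsBBPoly bb288.B :=
  ⟨⟨(Fin.ofNat 12 3, 0), (0, Fin.ofNat 12 2), (0, Fin.ofNat 12 7), by decide, by decide, by decide,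
      ⟨Or.inr rfl, Or.inl rfl, Or.inl rfl⟩, rfl⟩,
    ⟨(0, Fin.ofNat 12 3), (Fin.ofNat 12 1, 0), (Fin.ofNat 12 2, 0), by decide, by decide, by decide,
      ⟨Or.inl rfl, Or.inr rfl, Or.inr rfl⟩, rfl⟩⟩

end Instances

end BB

end Literature.InformationTheory.QuantumCodes

/-! ### Flat-index bridge: `QC(A, B)` re-indexed to `Fin (ℓm)` checks × `Fin (ℓm + ℓm)` qubits
(`Code.HXFlat`, `Code.HZFlat`, §index) is a CSS code `Code.cssFlat` with the SAME `d^X`, `d^Z`, `k` as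
`Code.css` — the lemmas that let a distance certificate checked on flat bitmask matrices (qec
`Summits/Ventures/QEC/Census/CertCheck.lean`, rows indexed by `Fin n`) discharge statements about
`BB.bb72.css` etc. (`dX_eq_of_flat`, `dZ_eq_of_flat`, `k_eq_of_flat`). Pure re-indexing
(`Matrix.submatrix_mulVec_equiv`, `submatrix_vecMul_equiv`, `rank_reindex`); nothing printed is restated.
-/

namespace Literature.InformationTheory.QuantumCodes.BB

open Matrix

/-- Hamming weight is invariant under re-indexing the coordinates by an equivalence.
[cite: BravyiEtAl2024, §4 "|v| = Σᵢ vᵢ is the Hamming weight of a vector v ∈ 𝔽₂ⁿ" (arXiv:2308.07915 chunk p0009 L41)] -/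
theorem hammingNorm_comp_equiv {α β R : Type*} [Fintype α] [Fintype β] [Zero R] [DecidableEq R]
    (v : β → R) (e : α ≃ β) : hammingNorm (v ∘ e) = hammingNorm v := by
  unfold hammingNorm
  exact Finset.card_equiv e (fun i => by simp)

namespace Code

variable {ℓ m : ℕ} (C : Code ℓ m)

/-- `HXFlat` is `H^X` with rows re-indexed by `checkIndex⁻¹` and columns by `qubitIndex⁻¹` (definitional).
[cite: BravyiEtAl2024, §4 (arXiv:2308.07915 chunk p0009 L16 and L28–32)] -/
theorem HXFlat_eq_submatrix : C.HXFlat = C.HX.submatrix checkIndex.symm qubitIndex.symm := rfl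

/-- `HZFlat` is `H^Z` re-indexed likewise (definitional). [cite: BravyiEtAl2024, §4 (arXiv:2308.07915 chunk p0009 L16 and L28–32)] -/
theorem HZFlat_eq_submatrix : C.HZFlat = C.HZ.submatrix checkIndex.symm qubitIndex.symm := rfl

/-- `HXFlat v = (H^X (v ∘ qubitIndex))` re-indexed: matrix–vector products commute with the flattening.
[cite: BravyiEtAl2024, §4 (arXiv:2308.07915 chunk p0009 L28–34: rows of H^X act on 𝔽₂ⁿ)] -/
theorem HXFlat_mulVec (v : Fin (ℓ * m + ℓ * m) → ZMod 2) :
    C.HXFlat *ᵥ v = (C.HX *ᵥ (v ∘ qubitIndex)) ∘ checkIndex.symm := by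
  rw [HXFlat_eq_submatrix, submatrix_mulVec_equiv, Equiv.symm_symm]

/-- `HZFlat v = (H^Z (v ∘ qubitIndex))` re-indexed. [cite: BravyiEtAl2024, §4 (arXiv:2308.07915 chunk p0009 L28–34)] -/
theorem HZFlat_mulVec (v : Fin (ℓ * m + ℓ * m) → ZMod 2) :
    C.HZFlat *ᵥ v = (C.HZ *ᵥ (v ∘ qubitIndex)) ∘ checkIndex.symm := by
  rw [HZFlat_eq_submatrix, submatrix_mulVec_equiv, Equiv.symm_symm]

/-- Kernel transport: `HXFlat v = 0 ↔ H^X (v ∘ qubitIndex) = 0`.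
[cite: BravyiEtAl2024, §4 (arXiv:2308.07915 chunk p0009 L28–34)] -/
theorem HXFlat_mulVec_eq_zero_iff (v : Fin (ℓ * m + ℓ * m) → ZMod 2) :
    C.HXFlat *ᵥ v = 0 ↔ C.HX *ᵥ (v ∘ qubitIndex) = 0 := by
  rw [HXFlat_mulVec]
  refine ⟨fun h => funext fun i => ?_, fun h => by rw [h]; rfl⟩
  simpa using congr_fun h (checkIndex i)

/-- Kernel transport for `H^Z`: `HZFlat v = 0 ↔ H^Z (v ∘ qubitIndex) = 0`.
[cite: BravyiEtAl2024, §4 (arXiv:2308.07915 chunk p0009 L28–34)] -/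
theorem HZFlat_mulVec_eq_zero_iff (v : Fin (ℓ * m + ℓ * m) → ZMod 2) :
    C.HZFlat *ᵥ v = 0 ↔ C.HZ *ᵥ (v ∘ qubitIndex) = 0 := by
  rw [HZFlat_mulVec]
  refine ⟨fun h => funext fun i => ?_, fun h => by rw [h]; rfl⟩
  simpa using congr_fun h (checkIndex i)

/-- Row-space transport: `v ∈ rs HXFlat ↔ v ∘ qubitIndex ∈ rs H^X`.
[cite: BravyiEtAl2024, §4 and Table 1 notation "rs" (arXiv:2308.07915 chunk p0009 L36–40)] -/
theorem mem_rowSpace_HXFlat_iff [NeZero ℓ] [NeZero m] (v : Fin (ℓ * m + ℓ * m) → ZMod 2) :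
    v ∈ rowSpace C.HXFlat ↔ v ∘ qubitIndex ∈ rowSpace C.HX := by
  rw [mem_rowSpace_iff, mem_rowSpace_iff]
  constructor
  · rintro ⟨w, hw⟩
    refine ⟨w ∘ checkIndex, ?_⟩
    rw [← hw, HXFlat_eq_submatrix, submatrix_vecMul_equiv, Equiv.symm_symm]
    funext q
    simp
  · rintro ⟨w, hw⟩
    refine ⟨w ∘ checkIndex.symm, ?_⟩
    have hw' : (w ∘ ⇑(checkIndex (ℓ := ℓ) (m := m)).symm) ∘ ⇑checkIndex = w := by
      funext i; simp
    rw [HXFlat_eq_submatrix, submatrix_vecMul_equiv, Equiv.symm_symm, hw', hw]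
    funext q
    simp

/-- Row-space transport for `H^Z`: `v ∈ rs HZFlat ↔ v ∘ qubitIndex ∈ rs H^Z`.
[cite: BravyiEtAl2024, §4 and Table 1 notation "rs" (arXiv:2308.07915 chunk p0009 L36–40)] -/
theorem mem_rowSpace_HZFlat_iff [NeZero ℓ] [NeZero m] (v : Fin (ℓ * m + ℓ * m) → ZMod 2) :
    v ∈ rowSpace C.HZFlat ↔ v ∘ qubitIndex ∈ rowSpace C.HZ := by
  rw [mem_rowSpace_iff, mem_rowSpace_iff]
  constructor
  · rintro ⟨w, hw⟩
    refine ⟨w ∘ checkIndex, ?_⟩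
    rw [← hw, HZFlat_eq_submatrix, submatrix_vecMul_equiv, Equiv.symm_symm]
    funext q
    simp
  · rintro ⟨w, hw⟩
    refine ⟨w ∘ checkIndex.symm, ?_⟩
    have hw' : (w ∘ ⇑(checkIndex (ℓ := ℓ) (m := m)).symm) ∘ ⇑checkIndex = w := by
      funext i; simp
    rw [HZFlat_eq_submatrix, submatrix_vecMul_equiv, Equiv.symm_symm, hw', hw]
    funext q
    simp

variable [NeZero ℓ] [NeZero m]

/-- CSS commutation survives re-indexing: `HXFlat · HZFlatᵀ = 0`.
[cite: BravyiEtAl2024, §4 (arXiv:2308.07915 chunk p0009 L35)] -/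
theorem HXFlat_mul_HZFlat_transpose : C.HXFlat * C.HZFlatᵀ = 0 := by
  rw [HXFlat_eq_submatrix, HZFlat_eq_submatrix, transpose_submatrix, submatrix_mul_equiv,
    HX_mul_HZ_transpose]
  rfl

/-- `QC(A, B)` as a CSS code on FLAT indices (`Fin (ℓm)` `X`-checks, `Fin (ℓm)` `Z`-checks,
`Fin (ℓm + ℓm)` qubits, §index convention) — the shape the qec certificate checker produces.
[cite: BravyiEtAl2024, §4 (arXiv:2308.07915 chunk p0009 L25–35)] -/
def cssFlat : CSSCode (Fin (ℓ * m)) (Fin (ℓ * m)) (Fin (ℓ * m + ℓ * m)) :=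
  ⟨C.HXFlat, C.HZFlat, C.HXFlat_mul_HZFlat_transpose⟩

/-- `C.cssFlat.HX = C.HXFlat`. [cite: BravyiEtAl2024, §4 (arXiv:2308.07915 chunk p0009 L28–31)] -/
@[simp] theorem cssFlat_HX : C.cssFlat.HX = C.HXFlat := rfl

/-- `C.cssFlat.HZ = C.HZFlat`. [cite: BravyiEtAl2024, §4 (arXiv:2308.07915 chunk p0009 L28–31)] -/
@[simp] theorem cssFlat_HZ : C.cssFlat.HZ = C.HZFlat := rfl

/-- Re-indexing preserves the `X`-distance: `d^X(cssFlat) = d^X(css)` (the weight-preserving bijection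
`v ↦ v ∘ qubitIndex` maps `ker HZFlat ∖ rs HXFlat` onto `ker H^Z ∖ rs H^X`).
[cite: BravyiEtAl2024, §4, proof of Lemma 1 ("d^X = min{|v| : v ∈ ker H^Z ∖ rs H^X}") (arXiv:2308.07915 chunk p0009 L115)] -/
theorem cssFlat_dX : C.cssFlat.dX = C.css.dX := by
  unfold CSSCode.dX
  congr 1
  refine Set.ext fun w => ⟨?_, ?_⟩
  · rintro ⟨v, ⟨hv, hv'⟩, rfl⟩
    have hv₁ : C.HZFlat *ᵥ v = 0 := hv
    refine ⟨v ∘ qubitIndex, ⟨?_, fun h => hv' ?_⟩, hammingNorm_comp_equiv v qubitIndex⟩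
    · exact (C.HZFlat_mulVec_eq_zero_iff v).1 hv₁
    · exact (C.mem_rowSpace_HXFlat_iff v).2 h
  · rintro ⟨u, ⟨hu, hu'⟩, rfl⟩
    have hu₁ : C.HZ *ᵥ u = 0 := hu
    have hcomp : (u ∘ qubitIndex.symm) ∘ qubitIndex = u := by
      funext q; simp
    refine ⟨u ∘ qubitIndex.symm, ⟨?_, fun h => hu' ?_⟩, ?_⟩
    · exact (C.HZFlat_mulVec_eq_zero_iff _).2 (by rw [hcomp]; exact hu₁)
    · have h' := (C.mem_rowSpace_HXFlat_iff _).1 h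
      rwa [hcomp] at h'
    · rw [← hammingNorm_comp_equiv (u ∘ qubitIndex.symm) qubitIndex, hcomp]

/-- Re-indexing preserves the `Z`-distance: `d^Z(cssFlat) = d^Z(css)`.
[cite: BravyiEtAl2024, §4, proof of Lemma 1 ("d^Z = min{|v| : v ∈ ker H^X ∖ rs H^Z}") (arXiv:2308.07915 chunk p0009 L117)] -/
theorem cssFlat_dZ : C.cssFlat.dZ = C.css.dZ := by
  rw [CSSCode.dZ_eq, CSSCode.dZ_eq]
  congr 1
  refine Set.ext fun w => ⟨?_, ?_⟩
  · rintro ⟨v, ⟨hv, hv'⟩, rfl⟩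
    have hv₁ : C.HXFlat *ᵥ v = 0 := hv
    refine ⟨v ∘ qubitIndex, ⟨?_, fun h => hv' ?_⟩, hammingNorm_comp_equiv v qubitIndex⟩
    · exact (C.HXFlat_mulVec_eq_zero_iff v).1 hv₁
    · exact (C.mem_rowSpace_HZFlat_iff v).2 h
  · rintro ⟨u, ⟨hu, hu'⟩, rfl⟩
    have hu₁ : C.HX *ᵥ u = 0 := hu
    have hcomp : (u ∘ qubitIndex.symm) ∘ qubitIndex = u := by
      funext q; simp
    refine ⟨u ∘ qubitIndex.symm, ⟨?_, fun h => hu' ?_⟩, ?_⟩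
    · exact (C.HXFlat_mulVec_eq_zero_iff _).2 (by rw [hcomp]; exact hu₁)
    · have h' := (C.mem_rowSpace_HZFlat_iff _).1 h
      rwa [hcomp] at h'
    · rw [← hammingNorm_comp_equiv (u ∘ qubitIndex.symm) qubitIndex, hcomp]

/-- Re-indexing preserves the number of logical qubits: `k(cssFlat) = k(css)` (ranks and qubit counts
are invariant under `Matrix.reindex`). [cite: BravyiEtAl2024, proof of Lemma 1 "k = n − rk H^X − rk H^Z" (arXiv:2308.07915 chunk p0009 L80–83)] -/
theorem cssFlat_k : C.cssFlat.k = C.k := by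
  rw [k, CSSCode.k_eq, CSSCode.k_eq, cssFlat_HX, cssFlat_HZ, css_HX, css_HZ, HXFlat, HZFlat,
    rank_reindex, rank_reindex, Fintype.card_congr (qubitIndex (ℓ := ℓ) (m := m)).symm]

/-- **Discharge bridge, `X` side.** Any CSS code on the flat index types whose check matrices are
literally `HXFlat`, `HZFlat` (e.g. the code a qec distance certificate is checked against, after
`decide`-ing the two matrix equalities) has the `X`-distance of `QC(A, B)`.
[cite: BravyiEtAl2024, §4, proof of Lemma 1 (arXiv:2308.07915 chunk p0009 L108–118)] -/
theorem dX_eq_of_flat {D : CSSCode (Fin (ℓ * m)) (Fin (ℓ * m)) (Fin (ℓ * m + ℓ * m))}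
    (hX : D.HX = C.HXFlat) (hZ : D.HZ = C.HZFlat) : D.dX = C.css.dX := by
  obtain ⟨DX, DZ, hc⟩ := D
  subst hX; subst hZ
  exact C.cssFlat_dX

/-- **Discharge bridge, `Z` side** (see `dX_eq_of_flat`). [cite: BravyiEtAl2024, §4, proof of Lemma 1 (arXiv:2308.07915 chunk p0009 L108–118)] -/
theorem dZ_eq_of_flat {D : CSSCode (Fin (ℓ * m)) (Fin (ℓ * m)) (Fin (ℓ * m + ℓ * m))}
    (hX : D.HX = C.HXFlat) (hZ : D.HZ = C.HZFlat) : D.dZ = C.css.dZ := by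
  obtain ⟨DX, DZ, hc⟩ := D
  subst hX; subst hZ
  exact C.cssFlat_dZ

/-- **Discharge bridge, dimension** (see `dX_eq_of_flat`). [cite: BravyiEtAl2024, proof of Lemma 1 "k = n − rk H^X − rk H^Z" (arXiv:2308.07915 chunk p0009 L80–83)] -/
theorem k_eq_of_flat {D : CSSCode (Fin (ℓ * m)) (Fin (ℓ * m)) (Fin (ℓ * m + ℓ * m))}
    (hX : D.HX = C.HXFlat) (hZ : D.HZ = C.HZFlat) : D.k = C.k := by
  obtain ⟨DX, DZ, hc⟩ := D
  subst hX; subst hZ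
  exact C.cssFlat_k

end Code

/-! #### Kernel-checked instances of the index convention (cross-checks for kernels / emitter / referees) -/

/-- The worked `2 × 2` example of the qec certificate format (§index): `ℓ = m = 2`, `A = x`, `B = y`;
flat indices `(0,0)↦0, (0,1)↦1, (1,0)↦2, (1,1)↦3`; `H^X` row `0` has support `{2, 5}` (`x` sends
`0 → 2`; `y` sends `0 → 1`, shifted by `4` into block `R`) and `H^Z` row `0` has support `{1, 6}`.
Proved by `decide` — the Lean convention agrees with the kernels' convention on this example.
[cite: BravyiEtAl2024, §4 (arXiv:2308.07915 chunk p0009 L3–16 and L28–31: S_ℓ, x = S_ℓ ⊗ I_m, y = I_ℓ ⊗ S_m, H^X = [A|B], H^Z = [B^T|A^T])] -/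
theorem indexConvention_example :
    (Finset.univ.filter fun q : Fin (2 * 2 + 2 * 2) => (⟨x, y⟩ : Code 2 2).HXFlat 0 q ≠ 0) = {2, 5} ∧
    (Finset.univ.filter fun q : Fin (2 * 2 + 2 * 2) => (⟨x, y⟩ : Code 2 2).HZFlat 0 q ≠ 0) = {1, 6} := by
  decide

/-- Row `0` (check `(0,0)`) of `H^X` and of `H^Z` of the `[[72,12,6]]` instance in the flat convention:
supports `{1, 2, 18, 39, 42, 48}` (`A = x³ + y + y²`: columns `(3,0)↦18, (0,1)↦1, (0,2)↦2`;
`B = y³ + x + x²`: `36 + 3, 36 + 6, 36 + 12`) and `{3, 24, 30, 40, 41, 54}` (`Bᵀ`: `(0,−3)↦3,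
(−1,0)↦30, (−2,0)↦24`; `Aᵀ`: `36 + (−3,0)↦54, (0,−1)↦41, (0,−2)↦40`). Proved by `decide`; these are
the first rows of the qec cell's generator file for this code (census family BB, code id BB72).
[cite: BravyiEtAl2024, §4 (arXiv:2308.07915 chunk p0009 L23 and L28–31)] -/
theorem bb72_row_zero :
    (Finset.univ.filter fun q : Fin (6 * 6 + 6 * 6) => bb72.HXFlat 0 q ≠ 0) = {1, 2, 18, 39, 42, 48} ∧
    (Finset.univ.filter fun q : Fin (6 * 6 + 6 * 6) => bb72.HZFlat 0 q ≠ 0) = {3, 24, 30, 40, 41, 54} := by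
  decide

end Literature.InformationTheory.QuantumCodes.BB

/-! ### Pointwise transport of certificate statements from flat indices to `QC(A, B).css`
(appended 2026-08-26, for the closers of the qec route items typed over `BB.bb72.css`): a LOWER BOUND
"every `Z`-logical has weight `≥ d`" and a WITNESS "some `Z`-logical has weight `d`" checked on any
CSS code `D` on `Fin (ℓm) / Fin (ℓm) / Fin (ℓm+ℓm)` with `D.HX = HXFlat`, `D.HZ = HZFlat` transfer
verbatim to `C.css` (and the `X`-side twins). Pure re-indexing. -/

namespace Literature.InformationTheory.QuantumCodes.BB.Code

open Matrix

variable {ℓ m : ℕ} [NeZero ℓ] [NeZero m] (C : Code ℓ m)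

/-- LOWER-BOUND transport, `Z` side: if every `w` with `D.HX w = 0`, `w ∉ rs D.HZ` has weight `≥ d` on the
flat code `D = (HXFlat, HZFlat)`, then every `v` with `H^X v = 0`, `v ∉ rs H^Z` on `QC(A,B).css` has
weight `≥ d`. [cite: BravyiEtAl2024, §4, proof of Lemma 1 ("d^Z = min{|v| : v ∈ ker H^X ∖ rs H^Z}") (arXiv:2308.07915 chunk p0009 L117)] -/
theorem zLowerBound_of_flat {D : CSSCode (Fin (ℓ * m)) (Fin (ℓ * m)) (Fin (ℓ * m + ℓ * m))}
    (hX : D.HX = C.HXFlat) (hZ : D.HZ = C.HZFlat) {d : ℕ}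
    (h : ∀ w : Fin (ℓ * m + ℓ * m) → ZMod 2, D.HX *ᵥ w = 0 → w ∉ D.rowSpZ → d ≤ hammingNorm w) :
    ∀ v : Mono ℓ m ⊕ Mono ℓ m → ZMod 2, C.css.HX *ᵥ v = 0 → v ∉ C.css.rowSpZ → d ≤ hammingNorm v := by
  intro v hv hv'
  have hcomp : (v ∘ qubitIndex.symm) ∘ qubitIndex = v := by funext q; simp
  have h1 : D.HX *ᵥ (v ∘ qubitIndex.symm) = 0 := by
    rw [hX, C.HXFlat_mulVec_eq_zero_iff, hcomp]; exact hv
  have h2 : v ∘ qubitIndex.symm ∉ D.rowSpZ := by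
    intro hmem
    have hmem' : v ∘ qubitIndex.symm ∈ rowSpace C.HZFlat := by rw [← hZ]; exact hmem
    rw [C.mem_rowSpace_HZFlat_iff, hcomp] at hmem'
    exact hv' hmem'
  have h3 := h _ h1 h2
  rwa [← hammingNorm_comp_equiv (v ∘ qubitIndex.symm) qubitIndex, hcomp] at h3

/-- LOWER-BOUND transport, `X` side. [cite: BravyiEtAl2024, §4, proof of Lemma 1 ("d^X = min{|v| : v ∈ ker H^Z ∖ rs H^X}") (arXiv:2308.07915 chunk p0009 L115)] -/
theorem xLowerBound_of_flat {D : CSSCode (Fin (ℓ * m)) (Fin (ℓ * m)) (Fin (ℓ * m + ℓ * m))}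
    (hX : D.HX = C.HXFlat) (hZ : D.HZ = C.HZFlat) {d : ℕ}
    (h : ∀ w : Fin (ℓ * m + ℓ * m) → ZMod 2, D.HZ *ᵥ w = 0 → w ∉ D.rowSpX → d ≤ hammingNorm w) :
    ∀ v : Mono ℓ m ⊕ Mono ℓ m → ZMod 2, C.css.HZ *ᵥ v = 0 → v ∉ C.css.rowSpX → d ≤ hammingNorm v := by
  intro v hv hv'
  have hcomp : (v ∘ qubitIndex.symm) ∘ qubitIndex = v := by funext q; simp
  have h1 : D.HZ *ᵥ (v ∘ qubitIndex.symm) = 0 := by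
    rw [hZ, C.HZFlat_mulVec_eq_zero_iff, hcomp]; exact hv
  have h2 : v ∘ qubitIndex.symm ∉ D.rowSpX := by
    intro hmem
    have hmem' : v ∘ qubitIndex.symm ∈ rowSpace C.HXFlat := by rw [← hX]; exact hmem
    rw [C.mem_rowSpace_HXFlat_iff, hcomp] at hmem'
    exact hv' hmem'
  have h3 := h _ h1 h2
  rwa [← hammingNorm_comp_equiv (v ∘ qubitIndex.symm) qubitIndex, hcomp] at h3

/-- WITNESS transport, `Z` side: a flat `Z`-logical of weight `d` on `D = (HXFlat, HZFlat)` gives a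
`Z`-logical of weight `d` on `QC(A,B).css`. [cite: BravyiEtAl2024, §4, proof of Lemma 1 (arXiv:2308.07915 chunk p0009 L117)] -/
theorem zWitness_of_flat {D : CSSCode (Fin (ℓ * m)) (Fin (ℓ * m)) (Fin (ℓ * m + ℓ * m))}
    (hX : D.HX = C.HXFlat) (hZ : D.HZ = C.HZFlat) {d : ℕ}
    (h : ∃ w : Fin (ℓ * m + ℓ * m) → ZMod 2, D.HX *ᵥ w = 0 ∧ w ∉ D.rowSpZ ∧ hammingNorm w = d) :
    ∃ v : Mono ℓ m ⊕ Mono ℓ m → ZMod 2, C.css.HX *ᵥ v = 0 ∧ v ∉ C.css.rowSpZ ∧ hammingNorm v = d := by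
  obtain ⟨w, hw, hw', hwd⟩ := h
  refine ⟨w ∘ qubitIndex, ?_, fun hmem => hw' ?_, by rw [hammingNorm_comp_equiv]; exact hwd⟩
  · rw [hX] at hw
    exact (C.HXFlat_mulVec_eq_zero_iff w).1 hw
  · show w ∈ rowSpace D.HZ
    rw [hZ]
    exact (C.mem_rowSpace_HZFlat_iff w).2 hmem

/-- WITNESS transport, `X` side. [cite: BravyiEtAl2024, §4, proof of Lemma 1 (arXiv:2308.07915 chunk p0009 L115)] -/
theorem xWitness_of_flat {D : CSSCode (Fin (ℓ * m)) (Fin (ℓ * m)) (Fin (ℓ * m + ℓ * m))}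
    (hX : D.HX = C.HXFlat) (hZ : D.HZ = C.HZFlat) {d : ℕ}
    (h : ∃ w : Fin (ℓ * m + ℓ * m) → ZMod 2, D.HZ *ᵥ w = 0 ∧ w ∉ D.rowSpX ∧ hammingNorm w = d) :
    ∃ v : Mono ℓ m ⊕ Mono ℓ m → ZMod 2, C.css.HZ *ᵥ v = 0 ∧ v ∉ C.css.rowSpX ∧ hammingNorm v = d := by
  obtain ⟨w, hw, hw', hwd⟩ := h
  refine ⟨w ∘ qubitIndex, ?_, fun hmem => hw' ?_, by rw [hammingNorm_comp_equiv]; exact hwd⟩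
  · rw [hZ] at hw
    exact (C.HZFlat_mulVec_eq_zero_iff w).1 hw
  · show w ∈ rowSpace D.HX
    rw [hX]
    exact (C.mem_rowSpace_HXFlat_iff w).2 hmem

end Literature.InformationTheory.QuantumCodes.BB.Code
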